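import Summits.Ventures.AbcSig.Rows.Bridge
import Summits.Ventures.AbcSig.Rows.C2aL277A6
import Summits.Ventures.AbcSig.Rows.C2aL277A6AB

/-!
# Venture AbcSig — CELL `C2aL277A6`: the census statement `Rows.C2aCellRed 277 (fun a => 6 ≤ a) {11, 13, 23, 139}` from the two row theorems

HONEST FRAMING. COMPUTATION cell `pub-abcsig`; CONDITIONAL theorem; no claim on ABC or any summit. Hypotheses exactly as
in `Rows/C2aL277A6.lean` and `Rows/C2aL277A6AB.lean`: `BS04Package` (CITED), `DataComplete …` (COMPUTED level files), and the
rows' per-orbit exclusions for BOTH family predicates (`famB`, `famAB`) as `∀ n a m, …` hypotheses (CITED: the census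
row's certificates). Conclusion = p1's census predicate (`Rows/Statements.lean`), all four coprime coefficient
distributions `A·B = 2^a·277^m`, reduced exponents `a < n`, `m < n` (RULING H1). GENERATED by plean/make_cell_bridges.py.
-/

namespace Summit.Ventures.AbcSig

/-- Cell `C2aL277A6`: `Rows.C2aCellRed 277 (fun a => 6 ≤ a) {11, 13, 23, 139}` under the rows' hypotheses. -/
theorem cell_C2aL277A6 (M : NewformModel) (hP : M.BS04Package)
    (hD277 : M.DataComplete 277 level277Orbits)
    (hD554 : M.DataComplete 554 level554Orbits) :
    Rows.C2aCellRed 277 (fun a => 6 ≤ a) {11, 13, 23, 139} :=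
  C2aCellRed_of_rows 277 (by norm_num) (by norm_num) _ _
    (fun n hn h11 hnℓ hR a m ha han hm hmn x y z h1 h2 =>
      row_C2aL277A6 M hP hD277 hD554 n hn h11 hnℓ (by simpa using hR) a m ha hm han hmn x y z h1 h2)
    (fun n hn h11 hnℓ hR a m ha han hm hmn x y z h1 h2 =>
      row_C2aL277A6AB M hP hD277 hD554 n hn h11 hnℓ (by simpa using hR) a m ha hm han hmn x y z h1 h2)

end Summit.Ventures.AbcSig
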